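import Summits.AtomisticToContinuum.FouriersLaw.Theses.VanishingNoiseTransfer
import Summits.AtomisticToContinuum.FouriersLaw.Theorems.OddSectorIrreversibilityBoundedResponse
import Literature.MathematicalPhysics.KineticTheory.VelocityFlipNoise

/-!
# Fixed-length noise continuity (stub S2 of line `fekete-usc-one-length`): closed cases and the
exact analytic residue

`--supports stmt-AtomisticToContinuum-11976` helper file (crux `VanishingNoiseBound`, route
`VanishingNoiseTransfer`, line `fekete-usc-one-length`, stub S2 `stub_fixedLengthNoiseContinuity`).

The stub asks, for `pinnedChain ω₂ lam β γ` (all parameters `> 0`), `T > 0` and ONE length `N`: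
if `μ0 T_L T_R` is the unique weak steady state (`OscillatorChain.IsSteadyState`) at every pair of
positive bath temperatures, with linear response `D0 = lim_{δ → 0, δ ≠ 0} J(μ0, δ)/δ`,
`J(μ, δ) := totalCurrent (μ (T + δ/2) (T - δ/2))`, then for every `η > 0` there is `ε₂ > 0` such
that for all flip rates `ε ∈ (0, ε₂]`, the unique weak flip-steady family `με`
(`OscillatorChain.IsFlipSteadyState`, Bernardin–Olla velocity flips at every site) and any response
`Dε` of it satisfy `|Dε - D0| ≤ η`.

Proved here (sorry-free, no new definitions):

* §1 two real-variable reductions of the conclusion `|Dε - D0| ≤ η`: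
  `abs_sub_le_of_eventually_abs_sub_le` (a mixed bound `|J(με,δ) - J(μ0,δ)| ≤ η|δ|` eventually
  along `δ → 0, δ ≠ 0` suffices) and the three-epsilon / Moore–Osgood splitting
  `abs_sub_le_of_near` used in §4;
* §2 the cases `N ≤ 1` of the stub, outright (`of_le_one`): a chain with at most one site has no
  bond, `totalCurrent ≡ 0`, so every response is `0` (`responseCoeff_eq_zero_of_le_one` of
  `OddSectorIrreversibilityBoundedResponse`);
* §3 the equilibrium anchor of every unique flip-steady family: on the diagonal it IS the Gibbs
  measure (by `pinnedChain_isFlipSteadyState_gibbsMeasure` and uniqueness; cf. the sibling helper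
  `NoiseLocality.StubResponseDensityNoisy.flipSteadyFamily_eq_gibbsMeasure`), hence `J(με, 0) = 0`
  (`totalCurrent_flipSteadyFamily_diag_eq_zero`) — without which no response quotient could
  converge;
* §4 `of_equidifferentiable_of_pointwise`: the stub's conclusion (all `N`) from TWO analytic inputs,
  stated inline as hypotheses — (P) continuity of the steady current in the flip rate at `ε = 0⁺`
  at each FIXED small `δ ≠ 0` (`J(με, δ) → J(μ0, δ)`; zeroth order, Hairer–Majda's first step,
  provable from the tree's Langevin semigroup by the resolvent representation of the flip steady
  state), and (E) equi-differentiability at `δ = 0` of the response quotients `J(με, δ)/δ`,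
  uniformly in small `ε` (a common modulus `ω(δ) → 0`) — the fixed-`N` linear-response input of
  Hairer–Majda type (differentiability of the flip-noisy semigroup in the bath temperatures with
  `ε`-uniform bounds), which is NOT in the tree and not in print for the jump-perturbed Langevin
  chain. After this file the stub is exactly (P) ∧ (E).
-/

noncomputable section

namespace Summit.AtomisticToContinuum.FouriersLaw.Theorems.FixedLengthNoiseContinuity

open MeasureTheory Filter Topology
open Literature.MathematicalPhysics.KineticTheory.HeatConduction

/-! ## §1 Real-variable reductions -/

/-- **Mixed-bound reduction.** If two response quotients `J₀(δ)/δ → D₀` and `J₁(δ)/δ → D₁` converge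
along `δ → 0, δ ≠ 0` and the numerators satisfy `|J₁(δ) - J₀(δ)| ≤ η |δ|` eventually, then
`|D₁ - D₀| ≤ η`. -/
theorem abs_sub_le_of_eventually_abs_sub_le {J₀ J₁ : ℝ → ℝ} {D₀ D₁ η : ℝ}
    (h₀ : Tendsto (fun δ : ℝ => J₀ δ / δ) (𝓝[≠] 0) (𝓝 D₀))
    (h₁ : Tendsto (fun δ : ℝ => J₁ δ / δ) (𝓝[≠] 0) (𝓝 D₁))
    (h : ∀ᶠ δ in 𝓝[≠] (0 : ℝ), |J₁ δ - J₀ δ| ≤ η * |δ|) : |D₁ - D₀| ≤ η := by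
  have hsub : Tendsto (fun δ : ℝ => |J₁ δ / δ - J₀ δ / δ|) (𝓝[≠] 0) (𝓝 |D₁ - D₀|) :=
    (h₁.sub h₀).abs
  refine le_of_tendsto hsub ?_
  filter_upwards [h, self_mem_nhdsWithin] with δ hδ hδ0
  have hδ0' : (δ : ℝ) ≠ 0 := hδ0
  rw [← sub_div, abs_div, div_le_iff₀ (abs_pos.2 hδ0')]
  exact hδ

/-- **Three-epsilon splitting at one `δ`.** If at some `δ ≠ 0` both quotients are within `a` of
their limits and the numerators are within `b |δ|` of each other, then `|D₁ - D₀| ≤ a + b + a`. -/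
theorem abs_sub_le_of_near {J₀δ J₁δ D₀ D₁ a b δ : ℝ} (hδ : δ ≠ 0)
    (h₀ : |J₀δ / δ - D₀| ≤ a) (h₁ : |J₁δ / δ - D₁| ≤ a) (h : |J₁δ - J₀δ| ≤ b * |δ|) :
    |D₁ - D₀| ≤ a + b + a := by
  have hq : |J₁δ / δ - J₀δ / δ| ≤ b := by
    rw [← sub_div, abs_div, div_le_iff₀ (abs_pos.2 hδ)]
    exact h
  calc |D₁ - D₀| = |(D₁ - J₁δ / δ) + (J₁δ / δ - J₀δ / δ) + (J₀δ / δ - D₀)| := by ring_nf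
    _ ≤ |(D₁ - J₁δ / δ) + (J₁δ / δ - J₀δ / δ)| + |J₀δ / δ - D₀| := abs_add_le _ _
    _ ≤ |D₁ - J₁δ / δ| + |J₁δ / δ - J₀δ / δ| + |J₀δ / δ - D₀| := by
        gcongr
        exact abs_add_le _ _
    _ ≤ a + b + a := by
        rw [abs_sub_comm] at h₁
        gcongr

/-! ## §2 Chains without bonds: the stub for `N ≤ 1` -/

/-- **The stub for chains with at most one site (`N ≤ 1`), outright** — verbatim the registered
statement of `stub_fixedLengthNoiseContinuity` with `N ≤ 1` added: both responses vanish
(`responseCoeff_eq_zero_of_le_one`: the quotient is identically `0` and limits along the proper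
filter `𝓝[≠] 0` are unique), so `|Dε - D0| = 0 ≤ η` with `ε₂ := 1`. None of the positivity,
steadiness or uniqueness hypotheses is used. -/
theorem of_le_one :
    ∀ ω₂ lam β γ : ℝ, 0 < ω₂ → 0 < lam → 0 < β → 0 < γ → ∀ T : ℝ, 0 < T → ∀ N : ℕ, N ≤ 1 →
      ∀ μ0 : ℝ → ℝ → Measure (PhaseSpace N),
        (∀ T_L T_R : ℝ, 0 < T_L → 0 < T_R →
          (pinnedChain ω₂ lam β γ).IsSteadyState N T_L T_R (μ0 T_L T_R) ∧
            ∀ ν : Measure (PhaseSpace N),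
              (pinnedChain ω₂ lam β γ).IsSteadyState N T_L T_R ν → ν = μ0 T_L T_R) →
        ∀ D0 : ℝ,
          Tendsto (fun δ : ℝ =>
            (pinnedChain ω₂ lam β γ).totalCurrent (μ0 (T + δ / 2) (T - δ / 2)) / δ)
            (𝓝[≠] 0) (𝓝 D0) →
          ∀ η : ℝ, 0 < η → ∃ ε₂ : ℝ, 0 < ε₂ ∧ ∀ ε : ℝ, 0 < ε → ε ≤ ε₂ →
            ∀ με : ℝ → ℝ → Measure (PhaseSpace N),
              (∀ T_L T_R : ℝ, 0 < T_L → 0 < T_R →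
                (pinnedChain ω₂ lam β γ).IsFlipSteadyState N T_L T_R ε (με T_L T_R) ∧
                  ∀ ν : Measure (PhaseSpace N),
                    (pinnedChain ω₂ lam β γ).IsFlipSteadyState N T_L T_R ε ν → ν = με T_L T_R) →
              ∀ Dε : ℝ,
                Tendsto (fun δ : ℝ =>
                  (pinnedChain ω₂ lam β γ).totalCurrent (με (T + δ / 2) (T - δ / 2)) / δ)
                  (𝓝[≠] 0) (𝓝 Dε) →
                |Dε - D0| ≤ η := by
  intro ω₂ lam β γ _ _ _ _ T _ N hN μ0 _ D0 hD0 η hη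
  refine ⟨1, one_pos, fun ε _ _ με _ Dε hDε => ?_⟩
  rw [responseCoeff_eq_zero_of_le_one _ hN μ0 hD0, responseCoeff_eq_zero_of_le_one _ hN με hDε,
    sub_zero, abs_zero]
  exact hη.le

/-- Registered helper sub-goal `helper_fixedLengthNoiseContinuityLeOne` of
stmt-AtomisticToContinuum-11976 (= `of_le_one`, the stub `stub_fixedLengthNoiseContinuity` for
chains with at most one site, in fully qualified one-line form). -/
theorem helper_fixedLengthNoiseContinuityLeOne : ∀ ω₂ lam β γ : ℝ, 0 < ω₂ → 0 < lam → 0 < β → 0 < γ → ∀ T : ℝ, 0 < T → ∀ N : ℕ, N ≤ 1 → ∀ μ0 : ℝ → ℝ → MeasureTheory.Measure (Literature.MathematicalPhysics.KineticTheory.HeatConduction.PhaseSpace N), (∀ T_L T_R : ℝ, 0 < T_L → 0 < T_R → (Literature.MathematicalPhysics.KineticTheory.HeatConduction.pinnedChain ω₂ lam β γ).IsSteadyState N T_L T_R (μ0 T_L T_R) ∧ ∀ ν : MeasureTheory.Measure (Literature.MathematicalPhysics.KineticTheory.HeatConduction.PhaseSpace N), (Literature.MathematicalPhysics.KineticTheory.HeatConduction.pinnedChain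 ω₂ lam β γ).IsSteadyState N T_L T_R ν → ν = μ0 T_L T_R) → ∀ D0 : ℝ, Filter.Tendsto (fun δ : ℝ => (Literature.MathematicalPhysics.KineticTheory.HeatConduction.pinnedChain ω₂ lam β γ).totalCurrent (μ0 (T + δ / 2) (T - δ / 2)) / δ) (nhdsWithin 0 {(0 : ℝ)}ᶜ) (nhds D0) → ∀ η : ℝ, 0 < η → ∃ ε₂ : ℝ, 0 < ε₂ ∧ ∀ ε : ℝ, 0 < ε → ε ≤ ε₂ → ∀ με : ℝ → ℝ → MeasureTheory.Measure (Literature.MathematicalPhysics.KineticTheory.HeatConduction.PhaseSpace N), (∀ T_L T_R : ℝ, 0 < T_L → 0 < T_R → (Literature.MathematicalPhysics.KineticTheory.HeatConduction.pinnedChain ω₂ lam β γ).IsFlipSteadyState N T_L T_R ε (με T_L T_R) ∧ ∀ ν : MeasureTheory.Measure (Literature.MathematicalPhysics.KineticTheory.HeatConduction.PhaseSpace N), (Literature.MathematicalPhysics.KineticTheory.HeatConduction.pinnedChain ω₂ lam β γ).IsFlipSteadyState N T_L T_R ε ν → ν = με T_L T_R) → ∀ Dε : ℝ, Filter.Tendsto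 (fun δ : ℝ => (Literature.MathematicalPhysics.KineticTheory.HeatConduction.pinnedChain ω₂ lam β γ).totalCurrent (με (T + δ / 2) (T - δ / 2)) / δ) (nhdsWithin 0 {(0 : ℝ)}ᶜ) (nhds Dε) → |Dε - D0| ≤ η :=
  of_le_one

/-! ## §3 The equilibrium anchor of a unique flip-steady family -/

section Pinned

variable {ω₂ lam β γ : ℝ}

/-- **No current at equal temperatures**, for every unique flip-steady family and every rate:
on the diagonal the family IS the Gibbs measure `Z⁻¹ e^{-H/T'} dq dp` (uniqueness at `(T', T')` and
`pinnedChain_isFlipSteadyState_gibbsMeasure`: the Gibbs measure is a flip steady state at every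
rate), which carries no current (`pinnedChain_totalCurrent_gibbsMeasure`):
`totalCurrent (με T' T') = 0`. In the stub's notation `J(με, 0) = 0`, the anchor of the response
quotient `J(με, δ)/δ`. -/
theorem totalCurrent_flipSteadyFamily_diag_eq_zero (hω : 0 < ω₂) (hl : 0 ≤ lam) (hβ : 0 ≤ β)
    {N : ℕ} {ε : ℝ} (με : ℝ → ℝ → Measure (PhaseSpace N))
    (hμε : ∀ T_L T_R : ℝ, 0 < T_L → 0 < T_R →
      (pinnedChain ω₂ lam β γ).IsFlipSteadyState N T_L T_R ε (με T_L T_R) ∧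
        ∀ ν : Measure (PhaseSpace N),
          (pinnedChain ω₂ lam β γ).IsFlipSteadyState N T_L T_R ε ν → ν = με T_L T_R)
    {T' : ℝ} (hT' : 0 < T') :
    (pinnedChain ω₂ lam β γ).totalCurrent (με T' T') = 0 := by
  rw [← (hμε T' T' hT' hT').2 _ (pinnedChain_isFlipSteadyState_gibbsMeasure hω hl hβ γ N hT' ε)]
  exact pinnedChain_totalCurrent_gibbsMeasure ω₂ lam β γ N T'

/-- The same anchor in the response variable: `J(με, δ) = 0` at `δ = 0`, i.e.
`totalCurrent (με (T + 0/2) (T - 0/2)) = 0` for `T > 0`. -/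
theorem totalCurrent_flipSteadyFamily_at_zero (hω : 0 < ω₂) (hl : 0 ≤ lam) (hβ : 0 ≤ β)
    {N : ℕ} {ε : ℝ} (με : ℝ → ℝ → Measure (PhaseSpace N))
    (hμε : ∀ T_L T_R : ℝ, 0 < T_L → 0 < T_R →
      (pinnedChain ω₂ lam β γ).IsFlipSteadyState N T_L T_R ε (με T_L T_R) ∧
        ∀ ν : Measure (PhaseSpace N),
          (pinnedChain ω₂ lam β γ).IsFlipSteadyState N T_L T_R ε ν → ν = με T_L T_R)
    {T : ℝ} (hT : 0 < T) :
    (pinnedChain ω₂ lam β γ).totalCurrent (με (T + 0 / 2) (T - 0 / 2)) = 0 := by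
  rw [zero_div, add_zero, sub_zero]
  exact totalCurrent_flipSteadyFamily_diag_eq_zero hω hl hβ με hμε hT

/-- A unique deterministic steady family is a unique flip-steady family at rate `0`
(`isFlipSteadyState_zero_iff`), so §3 applies to `μ0` as well. -/
theorem flipSteadyFamily_zero_of_steadyFamily {N : ℕ} (μ0 : ℝ → ℝ → Measure (PhaseSpace N))
    (hμ0 : ∀ T_L T_R : ℝ, 0 < T_L → 0 < T_R →
      (pinnedChain ω₂ lam β γ).IsSteadyState N T_L T_R (μ0 T_L T_R) ∧
        ∀ ν : Measure (PhaseSpace N),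
          (pinnedChain ω₂ lam β γ).IsSteadyState N T_L T_R ν → ν = μ0 T_L T_R) :
    ∀ T_L T_R : ℝ, 0 < T_L → 0 < T_R →
      (pinnedChain ω₂ lam β γ).IsFlipSteadyState N T_L T_R 0 (μ0 T_L T_R) ∧
        ∀ ν : Measure (PhaseSpace N),
          (pinnedChain ω₂ lam β γ).IsFlipSteadyState N T_L T_R 0 ν → ν = μ0 T_L T_R := by
  intro T_L T_R hL hR
  simp only [OscillatorChain.isFlipSteadyState_zero_iff]
  exact hμ0 T_L T_R hL hR

end Pinned

/-! ## §4 The stub from (P) pointwise flip-continuity and (E) equi-differentiability -/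

section Reduction

variable {ω₂ lam β γ : ℝ}

/-- **`stub_fixedLengthNoiseContinuity` ⟸ (P) ∧ (E)**, at fixed parameters, temperature `T > 0`
and length `N`, for the given unique deterministic family `μ0` with response `D0`. (P): for all
sufficiently small `δ ≠ 0` the steady current `J(με, δ) = totalCurrent (με (T+δ/2) (T-δ/2))` of
the unique flip-steady family tends to `J(μ0, δ)` as `ε → 0⁺`. (E): the response quotients
`J(με, δ)/δ` converge to their limits `Dε` with a modulus `ω(δ) → 0` common to all small `ε > 0`
on a common punctured neighbourhood of `δ = 0`. Then for every `η > 0` there is `ε₂ > 0` with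
`|Dε - D0| ≤ η` for all `ε ∈ (0, ε₂]`: fix one small `δ ≠ 0` with `ω(δ) ≤ η/3` and
`|J(μ0,δ)/δ - D0| ≤ η/3`, then take `ε` so small that `|J(με,δ) - J(μ0,δ)| ≤ (η/3)|δ|`
(`abs_sub_le_of_near`). -/
theorem of_equidifferentiable_of_pointwise {T : ℝ} {N : ℕ}
    (μ0 : ℝ → ℝ → Measure (PhaseSpace N)) {D0 : ℝ}
    (hD0 : Tendsto (fun δ : ℝ =>
      (pinnedChain ω₂ lam β γ).totalCurrent (μ0 (T + δ / 2) (T - δ / 2)) / δ) (𝓝[≠] 0) (𝓝 D0))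
    (hP : ∀ᶠ δ in 𝓝[≠] (0 : ℝ), ∀ κ : ℝ, 0 < κ → ∃ ε₃ : ℝ, 0 < ε₃ ∧ ∀ ε : ℝ, 0 < ε → ε ≤ ε₃ →
      ∀ με : ℝ → ℝ → Measure (PhaseSpace N),
        (∀ T_L T_R : ℝ, 0 < T_L → 0 < T_R →
          (pinnedChain ω₂ lam β γ).IsFlipSteadyState N T_L T_R ε (με T_L T_R) ∧
            ∀ ν : Measure (PhaseSpace N),
              (pinnedChain ω₂ lam β γ).IsFlipSteadyState N T_L T_R ε ν → ν = με T_L T_R) →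
        |(pinnedChain ω₂ lam β γ).totalCurrent (με (T + δ / 2) (T - δ / 2)) -
            (pinnedChain ω₂ lam β γ).totalCurrent (μ0 (T + δ / 2) (T - δ / 2))| ≤ κ)
    (hE : ∃ ω : ℝ → ℝ, Tendsto ω (𝓝[≠] 0) (𝓝 0) ∧ ∃ ε₁ : ℝ, 0 < ε₁ ∧
      ∀ᶠ δ in 𝓝[≠] (0 : ℝ), ∀ ε : ℝ, 0 < ε → ε ≤ ε₁ →
        ∀ με : ℝ → ℝ → Measure (PhaseSpace N),
          (∀ T_L T_R : ℝ, 0 < T_L → 0 < T_R →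
            (pinnedChain ω₂ lam β γ).IsFlipSteadyState N T_L T_R ε (με T_L T_R) ∧
              ∀ ν : Measure (PhaseSpace N),
                (pinnedChain ω₂ lam β γ).IsFlipSteadyState N T_L T_R ε ν → ν = με T_L T_R) →
          ∀ Dε : ℝ,
            Tendsto (fun δ' : ℝ =>
              (pinnedChain ω₂ lam β γ).totalCurrent (με (T + δ' / 2) (T - δ' / 2)) / δ')
              (𝓝[≠] 0) (𝓝 Dε) →
            |(pinnedChain ω₂ lam β γ).totalCurrent (με (T + δ / 2) (T - δ / 2)) / δ - Dε| ≤ ω δ) :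
    ∀ η : ℝ, 0 < η → ∃ ε₂ : ℝ, 0 < ε₂ ∧ ∀ ε : ℝ, 0 < ε → ε ≤ ε₂ →
      ∀ με : ℝ → ℝ → Measure (PhaseSpace N),
        (∀ T_L T_R : ℝ, 0 < T_L → 0 < T_R →
          (pinnedChain ω₂ lam β γ).IsFlipSteadyState N T_L T_R ε (με T_L T_R) ∧
            ∀ ν : Measure (PhaseSpace N),
              (pinnedChain ω₂ lam β γ).IsFlipSteadyState N T_L T_R ε ν → ν = με T_L T_R) →
        ∀ Dε : ℝ,
          Tendsto (fun δ : ℝ =>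
            (pinnedChain ω₂ lam β γ).totalCurrent (με (T + δ / 2) (T - δ / 2)) / δ)
            (𝓝[≠] 0) (𝓝 Dε) →
          |Dε - D0| ≤ η := by
  intro η hη
  obtain ⟨ω, hω, ε₁, hε₁, hEv⟩ := hE
  set P := pinnedChain ω₂ lam β γ with hP_def
  have hη3 : 0 < η / 3 := by positivity
  -- along `δ → 0, δ ≠ 0`: eventually `|ω δ| ≤ η/3` and `|J(μ0,δ)/δ - D0| ≤ η/3`
  have h1 : ∀ᶠ δ in 𝓝[≠] (0 : ℝ), |ω δ| ≤ η / 3 := by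
    have := (hω.abs).eventually (ge_mem_nhds (a := η / 3) (by simpa using hη3))
    simpa using this
  have h2 : ∀ᶠ δ in 𝓝[≠] (0 : ℝ),
      |P.totalCurrent (μ0 (T + δ / 2) (T - δ / 2)) / δ - D0| ≤ η / 3 := by
    have h := (tendsto_iff_norm_sub_tendsto_zero.1 hD0).eventually
      (ge_mem_nhds (a := η / 3) hη3)
    filter_upwards [h] with δ hδ
    simpa [Real.norm_eq_abs] using hδ
  -- pick ONE such `δ ≠ 0`
  have h0 : ∀ᶠ δ in 𝓝[≠] (0 : ℝ), δ ≠ 0 := eventually_mem_nhdsWithin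
  obtain ⟨δ, hδ0, hPδ, hEδ, h1δ, h2δ⟩ := (h0.and (hP.and (hEv.and (h1.and h2)))).exists
  -- (P) at this `δ` with tolerance `(η/3)|δ|`
  have hκ : 0 < η / 3 * |δ| := mul_pos hη3 (abs_pos.2 hδ0)
  obtain ⟨ε₃, hε₃, hPε⟩ := hPδ (η / 3 * |δ|) hκ
  refine ⟨min ε₁ ε₃, lt_min hε₁ hε₃, fun ε hε hεle με hμε Dε hDε => ?_⟩
  have hEε := hEδ ε hε (hεle.trans (min_le_left _ _)) με hμε Dε hDε
  have hPε' := hPε ε hε (hεle.trans (min_le_right _ _)) με hμε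
  have hωδ : ω δ ≤ η / 3 := (le_abs_self _).trans h1δ
  have key := abs_sub_le_of_near (D₀ := D0) (D₁ := Dε) hδ0 h2δ (hEε.trans hωδ) hPε'
  linarith

end Reduction

end Summit.AtomisticToContinuum.FouriersLaw.Theorems.FixedLengthNoiseContinuity

end
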